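import Summits.RiemannHypothesis.RiemannHypothesis.Theorems.SpectralTraceWindowTraceArchStubCausalCrystallisationAux
import Literature.NumberTheory.LFunctions.RiemannXiLogDeriv
import HarnessLib

/-!
# Growth and phase of the shifted ξ (`stub_xiPhase`)

Stub `stub_xiPhase` of the line `causal-level-sets` for the crux `WindowTraceArch`
(stmt-RiemannHypothesis-11195; skeleton
`Summit.RiemannHypothesis.RiemannHypothesis.Cruxes.WindowTraceArch.CausalLevelSets`).

**Statement.** Let `ξ = Literature.NumberTheory.LFunctions.riemannXi` be the completed zeta
function and `h > 1/2`. Then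
(i) there is `C` with `‖ξ'(s)/ξ(s)‖ ≤ C (1 + ‖s‖)` for every `s` with `Re s ≥ 3/4 + h/2`;
(ii) there is a phase `φ : ℝ → ℝ` with `ξ(1/2 + h − it) = |ξ(1/2 + h − it)| e^{−iφ(t)}` for all real
`t` and `φ(v) − φ(u) = ∫ᵤᵛ Re (ξ'/ξ)(1/2 + h + it) dt` for all real `u, v`.

**Proof.** Both parts live in the half-plane of absolute convergence (`3/4 + h/2 > 1`,
`1/2 + h > 1`); no zeros of `ζ` are involved.
* (i) On `Re s > 1`, `ξ'/ξ(s) = 1/s + 1/(s−1) − (log π)/2 + ½ψ(s/2) − Σ Λ(n) n^{-s}`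
  (`logDeriv_riemannXi_eq_of_one_lt_re`). For `Re s ≥ σ₀ := 3/4 + h/2 > 1`:
  `‖1/s‖ ≤ 1/σ₀`, `‖1/(s−1)‖ ≤ 1/(σ₀ − 1)`, `‖Σ Λ(n)n^{-s}‖ ≤ Σ Λ(n) n^{-σ₀}` (termwise
  monotonicity in `Re s`), and `‖ψ(w)‖ ≤ 1 + 4‖w − 1‖` for `Re w ≥ 1/2` from the series
  `ψ(w) + γ = Σₖ (1/(k+1) − 1/(w+k))` (Andrews–Askey–Roy (1.2.13), tree
  `hasSum_one_div_sub_one_div_digamma`), whose terms are `≤ 2‖w − 1‖/(k+1)²`; with `w = s/2`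
  this is linear in `‖s‖`, uniformly on the closed half-plane.
* (ii) `F(z) = ξ(1/2 + h − iz)` is entire without real zeros (`Re(1/2 + h − it) = 1/2 + h ≥ 1`),
  so (`causalCLS_phase`: integrate `F'/F` along `ℝ`) `F(t) = |F(t)| e^{iθ(t)}` with
  `θ'(t) = Im (F'(t)/F(t))`. Here `F'(t) = −i ξ'(1/2 + h − it)` and
  `1/2 + h − it = conj (1/2 + h + it)`, so by `ξ'(s̄) = conj ξ'(s)`, `ξ(s̄) = conj ξ(s)`:
  `Im (F'/F)(t) = −Re (ξ'/ξ)(1/2 + h + it)`. Put `φ = −θ`; `φ' = Re (ξ'/ξ)(1/2 + h + it)` is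
  continuous, and the fundamental theorem of calculus gives the increment formula.

**Sources.** E. Bombieri, Rend. Mat. Acc. Lincei (9) 11 (2000), §2 (the logarithmic derivative of
`π^{-s/2}Γ(s/2)ζ(s)` on the line of integration); G. E. Andrews, R. Askey, R. Roy, *Special
Functions* (1999), Thm. 1.2.5; L. de Branges, *Hilbert Spaces of Entire Functions* (1968), §§19–22
(phase functions). All ingredients are proved tree / Mathlib facts.
-/

set_option linter.dupNamespace false

noncomputable section

open Complex Set MeasureTheory Filter LSeries
open scoped Real Topology ComplexConjugate LSeries.notation ArithmeticFunction.vonMangoldt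

namespace Summit.RiemannHypothesis.RiemannHypothesis.Theorems.SpectralTraceWindowTraceArch

open Literature.NumberTheory.LFunctions

/-! ### A linear bound for `ψ` on `Re w ≥ 1/2` -/

/-- A linear bound for the digamma function on the closed half-plane `Re w ≥ 1/2`:
`‖ψ(w)‖ ≤ 1 + 4‖w − 1‖` (from `ψ(w) + γ = Σ (1/(k+1) − 1/(w+k))`, whose terms are
`≤ ‖w − 1‖/(½(k+1)²)`, `Σ 1/(k+1)² = π²/6 ≤ 5/3` and `γ < 2/3`). -/
theorem xiPhase_norm_digamma_le {w : ℂ} (hw : 1 / 2 ≤ w.re) : ‖digamma w‖ ≤ 1 + 4 * ‖w - 1‖ := by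
  -- adapted from `Literature/NumberTheory/LFunctions/ZetaZeroReciprocalSum.lean`,
  -- `norm_digamma_le_linear` (there `Re w ≥ 3/4`)
  have hw0 : 0 < w.re := by linarith
  have hs := Literature.Analysis.SpecialFunctions.Complex.hasSum_one_div_sub_one_div_digamma hw0
  have hmin : 1 / 2 ≤ min w.re 1 := le_min hw (by norm_num)
  -- the dominating series
  have hdom : HasSum (fun k : ℕ ↦ ‖w - 1‖ / (1 / 2) * (1 / ((k : ℝ) + 1) ^ 2))
      (‖w - 1‖ / (1 / 2) * (π ^ 2 / 6)) := by
    have h := (hasSum_nat_add_iff' 1).2 hasSum_zeta_two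
    simp only [Finset.range_one, Finset.sum_singleton, Nat.cast_zero, ne_eq, OfNat.ofNat_ne_zero,
      not_false_eq_true, zero_pow, div_zero, sub_zero, Nat.cast_add, Nat.cast_one] at h
    exact h.mul_left _
  have hle : ∀ k : ℕ, ‖1 / ((k : ℂ) + 1) - 1 / (w + k)‖ ≤
      ‖w - 1‖ / (1 / 2) * (1 / ((k : ℝ) + 1) ^ 2) := by
    intro k
    refine (Literature.Analysis.SpecialFunctions.Complex.norm_one_div_sub_one_div_le hw0 k).trans ?_
    rw [show ‖w - 1‖ / (1 / 2) * (1 / ((k : ℝ) + 1) ^ 2) = ‖w - 1‖ / (1 / 2 * ((k : ℝ) + 1) ^ 2) by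
      field_simp]
    exact div_le_div_of_nonneg_left (norm_nonneg _) (by positivity)
      (mul_le_mul_of_nonneg_right hmin (by positivity))
  have h1 : ‖digamma w + Real.eulerMascheroniConstant‖ ≤ ‖w - 1‖ / (1 / 2) * (π ^ 2 / 6) := by
    rw [← hs.tsum_eq]
    refine (norm_tsum_le_tsum_norm hs.summable.norm).trans ?_
    rw [← hdom.tsum_eq]
    exact hs.summable.norm.tsum_le_tsum hle hdom.summable
  have hγ : ‖(Real.eulerMascheroniConstant : ℂ)‖ ≤ 2 / 3 := by
    rw [Complex.norm_real, Real.norm_eq_abs, abs_of_pos (by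
      linarith [Real.one_half_lt_eulerMascheroniConstant])]
    linarith [Real.eulerMascheroniConstant_lt_two_thirds]
  have hπ : π ^ 2 / 6 ≤ 5 / 3 := by nlinarith [Real.pi_lt_d2, Real.pi_pos]
  have h2 : ‖digamma w‖ ≤ ‖digamma w + Real.eulerMascheroniConstant‖ +
      ‖(Real.eulerMascheroniConstant : ℂ)‖ := by
    have := norm_sub_le (digamma w + Real.eulerMascheroniConstant) (Real.eulerMascheroniConstant : ℂ)
    simpa using this
  have h3 : ‖w - 1‖ / (1 / 2) * (π ^ 2 / 6) ≤ 4 * ‖w - 1‖ := by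
    rw [div_mul_eq_mul_div, div_le_iff₀ (by norm_num)]
    nlinarith [norm_nonneg (w - 1)]
  linarith

/-! ### `Σ Λ(n) n^{-s}` and `ξ'/ξ` on a closed half-plane `Re s ≥ σ > 1` -/

/-- `|Σ Λ(n) n^{-s}| ≤ Σ Λ(n) n^{-σ}` for `Re s ≥ σ > 1` (termwise monotonicity in `Re s`). -/
theorem xiPhase_norm_LSeries_vonMangoldt_le {σ : ℝ} (hσ : 1 < σ) {s : ℂ} (hs : σ ≤ s.re) :
    ‖L ↗Λ s‖ ≤ ∑' n : ℕ, ‖term ↗Λ (σ : ℂ) n‖ := by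
  have hsumσ : Summable fun n ↦ ‖term ↗Λ (σ : ℂ) n‖ := by
    have h := ArithmeticFunction.LSeriesSummable_vonMangoldt (s := (σ : ℂ)) (by simpa using hσ)
    exact summable_norm_iff.mpr h
  have hle : ∀ n, ‖term ↗Λ s n‖ ≤ ‖term ↗Λ (σ : ℂ) n‖ := fun n ↦
    norm_term_le_of_re_le_re _ (by simpa using hs) n
  have hsum : Summable fun n ↦ ‖term ↗Λ s n‖ :=
    Summable.of_nonneg_of_le (fun _ ↦ norm_nonneg _) hle hsumσ
  calc ‖L ↗Λ s‖ = ‖∑' n, term ↗Λ s n‖ := rfl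
    _ ≤ ∑' n, ‖term ↗Λ s n‖ := norm_tsum_le_tsum_norm hsum
    _ ≤ ∑' n, ‖term ↗Λ (σ : ℂ) n‖ := hsum.tsum_le_tsum hle hsumσ

/-- **`ξ'/ξ` grows at most linearly on a closed half-plane `Re s ≥ σ > 1`**: there is `C` with
`‖ξ'(s)/ξ(s)‖ ≤ C (1 + ‖s‖)` whenever `Re s ≥ σ` (`1/s`, `1/(s−1)`, `log π` and `Σ Λ(n)n^{-s}`
are bounded there, `ψ(s/2)` is at most linear). -/
theorem xiPhase_exists_norm_logDeriv_le {σ : ℝ} (hσ : 1 < σ) :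
    ∃ C : ℝ, ∀ s : ℂ, σ ≤ s.re → ‖deriv riemannXi s / riemannXi s‖ ≤ C * (1 + ‖s‖) := by
  -- adapted from `Literature/NumberTheory/LFunctions/ZetaZeroReciprocalSum.lean`,
  -- `exists_norm_logDeriv_riemannXi_le_of_re_ge` (there `σ = 3/2`)
  set M : ℝ := ∑' n : ℕ, ‖term ↗Λ (σ : ℂ) n‖ with hM
  have hM0 : 0 ≤ M := tsum_nonneg fun _ ↦ norm_nonneg _
  have hσ0 : 0 < 1 / σ := by positivity
  have hσ1 : 0 < 1 / (σ - 1) := one_div_pos.2 (by linarith)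
  refine ⟨1 / σ + 1 / (σ - 1) + 4 + M, fun s hs ↦ ?_⟩
  have hre : 1 < s.re := by linarith
  rw [← logDeriv_apply, logDeriv_riemannXi_eq_of_one_lt_re hre]
  have hns : σ ≤ ‖s‖ := hs.trans (Complex.re_le_norm s)
  have h1 : ‖1 / s‖ ≤ 1 / σ := by
    rw [norm_div, norm_one]
    exact one_div_le_one_div_of_le (by linarith) hns
  have h2 : ‖1 / (s - 1)‖ ≤ 1 / (σ - 1) := by
    rw [norm_div, norm_one]
    have : σ - 1 ≤ ‖s - 1‖ := by
      have h := Complex.re_le_norm (s - 1)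
      simp only [sub_re, one_re] at h
      linarith
    exact one_div_le_one_div_of_le (by linarith) this
  have hπ : ‖(-(Real.log π : ℂ)) / 2‖ ≤ 1 := by
    rw [norm_div, norm_neg, Complex.norm_real, Real.norm_eq_abs, Complex.norm_two,
      abs_of_pos (Real.log_pos (by linarith [Real.pi_gt_three]))]
    linarith [log_pi_lt_two]
  have h4 : ‖L ↗Λ s‖ ≤ M := xiPhase_norm_LSeries_vonMangoldt_le hσ hs
  have hw : 1 / 2 ≤ (s / 2).re := by simp; linarith
  have hψlin : ‖(1 / 2 : ℂ) * digamma (s / 2)‖ ≤ 5 / 2 + ‖s‖ := by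
    rw [norm_mul, show ‖(1 / 2 : ℂ)‖ = 1 / 2 by simp]
    have h := xiPhase_norm_digamma_le hw
    have h' : ‖s / 2 - 1‖ ≤ ‖s‖ / 2 + 1 := by
      calc ‖s / 2 - 1‖ ≤ ‖s / 2‖ + ‖(1 : ℂ)‖ := norm_sub_le _ _
        _ = ‖s‖ / 2 + 1 := by simp
    nlinarith [norm_nonneg (s / 2 - 1), norm_nonneg s]
  have h3 : ‖-(Real.log π : ℂ) / 2 + 1 / 2 * digamma (s / 2)‖ ≤ 1 + (5 / 2 + ‖s‖) :=
    (norm_add_le _ _).trans (add_le_add hπ hψlin)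
  have hs0 : 0 ≤ ‖s‖ := norm_nonneg s
  calc ‖1 / s + 1 / (s - 1) + (-(Real.log π : ℂ) / 2 + 1 / 2 * digamma (s / 2)) - L ↗Λ s‖
      ≤ ‖1 / s + 1 / (s - 1) + (-(Real.log π : ℂ) / 2 + 1 / 2 * digamma (s / 2))‖ + ‖L ↗Λ s‖ :=
        norm_sub_le _ _
    _ ≤ ‖1 / s‖ + ‖1 / (s - 1)‖ + ‖-(Real.log π : ℂ) / 2 + 1 / 2 * digamma (s / 2)‖ +
        ‖L ↗Λ s‖ := by
        gcongr; exact norm_add₃_le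
    _ ≤ 1 / σ + 1 / (σ - 1) + (1 + (5 / 2 + ‖s‖)) + M := by gcongr
    _ ≤ (1 / σ + 1 / (σ - 1) + 4 + M) * (1 + ‖s‖) := by
        nlinarith [mul_nonneg hM0 hs0, mul_nonneg hσ0.le hs0, mul_nonneg hσ1.le hs0]

/-! ### The phase of `t ↦ ξ(1/2 + h − it)` -/

/-- **The integral phase of the shifted ξ.** For `h ≥ 1/2` there is `φ : ℝ → ℝ` with
`ξ(1/2 + h − it) = |ξ(1/2 + h − it)| e^{−iφ(t)}` and
`φ(v) − φ(u) = ∫ᵤᵛ Re (ξ'/ξ)(1/2 + h + it) dt` (the phase of the entire, real-zero-free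
`F(z) = ξ(1/2 + h − iz)` from `causalCLS_phase`, with `Im (F'/F)(t) = −Re (ξ'/ξ)(1/2 + h + it)` by
the chain rule and conjugation symmetry). -/
theorem xiPhase_exists_phase {h : ℝ} (hh : 1 / 2 ≤ h) :
    ∃ φ : ℝ → ℝ, (∀ t : ℝ, riemannXi (1 / 2 + h - I * t) =
        ((‖riemannXi (1 / 2 + h - I * t)‖ : ℝ) : ℂ) * cexp (-(((φ t : ℝ) : ℂ) * I))) ∧
      (∀ u v : ℝ, φ v - φ u =
        ∫ t in u..v, (deriv riemannXi (1 / 2 + h + t * I) / riemannXi (1 / 2 + h + t * I)).re) := by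
  set F : ℂ → ℂ := fun z => riemannXi (1 / 2 + h - I * z) with hF
  have hFd : Differentiable ℂ F := differentiable_riemannXi.comp (by fun_prop)
  have hF0 : ∀ t : ℝ, F t ≠ 0 := fun t =>
    riemannXi_ne_zero_of_one_le_re (by simp; linarith)
  obtain ⟨θ, hθd, hθ⟩ := causalCLS_phase hFd hF0
  -- the derivative of `F` along the real axis
  have hderF : ∀ t : ℝ, deriv F t = -I * deriv riemannXi (1 / 2 + h - I * t) := by
    intro t
    have h1 : HasDerivAt (fun z : ℂ => 1 / 2 + (h : ℂ) - I * z) (-I) t := by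
      have := ((hasDerivAt_id (t : ℂ)).const_mul I).const_sub (1 / 2 + (h : ℂ))
      simpa using this
    have h2 := (differentiable_riemannXi (1 / 2 + (h : ℂ) - I * t)).hasDerivAt.comp (t : ℂ) h1
    rw [show F = riemannXi ∘ fun z : ℂ => 1 / 2 + (h : ℂ) - I * z from rfl, h2.deriv]
    ring
  have hconj : ∀ t : ℝ, (1 / 2 + (h : ℂ) - I * t) = conj (1 / 2 + (h : ℂ) + t * I) := by
    intro t; apply Complex.ext <;> simp
  have hkey : ∀ t : ℝ, (deriv F t / F t).im =
      -(deriv riemannXi (1 / 2 + h + t * I) / riemannXi (1 / 2 + h + t * I)).re := by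
    intro t
    rw [hderF]
    simp only [hF]
    rw [hconj t, deriv_riemannXi_conj, riemannXi_conj_holds, mul_div_assoc, ← map_div₀,
      Complex.mul_im, Complex.conj_re, Complex.conj_im]
    simp
  -- the derivative of the phase `φ = -θ` and its continuity
  have hφd : ∀ t : ℝ, HasDerivAt (fun t => -θ t)
      (deriv riemannXi (1 / 2 + h + t * I) / riemannXi (1 / 2 + h + t * I)).re t := by
    intro t
    have := (hθd t).neg
    rwa [hkey, neg_neg] at this
  have hcont : Continuous fun t : ℝ =>
      (deriv riemannXi (1 / 2 + h + t * I) / riemannXi (1 / 2 + h + t * I)).re := by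
    have hc := continuous_logDeriv_riemannXi_vertical (c := 1 / 2 + h) (by linarith)
    have e : (fun y : ℝ => logDeriv riemannXi (((1 / 2 + h : ℝ) : ℂ) + y * I)) =
        fun t : ℝ => deriv riemannXi (1 / 2 + h + t * I) / riemannXi (1 / 2 + h + t * I) := by
      funext y; rw [logDeriv_apply]; push_cast; rfl
    rw [e] at hc
    exact Complex.continuous_re.comp hc
  refine ⟨fun t => -θ t, fun t => ?_, fun u v => ?_⟩
  · have e : cexp (-((((-θ t : ℝ) : ℂ)) * I)) = cexp (((θ t : ℝ) : ℂ) * I) := by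
      push_cast; rw [neg_mul, neg_neg]
    simp only [e]
    exact hθ t
  · rw [intervalIntegral.integral_eq_sub_of_hasDerivAt (fun t _ => hφd t)
      (hcont.intervalIntegrable u v)]

/-! ### The stub -/

/-- **stub_xiPhase — growth and phase of the shifted ξ.** For `h > 1/2`:
(i) `ξ'/ξ(s)` is at most linear on the closed half-plane `Re s ≥ 3/4 + h/2` (`> 1`);
(ii) there is a phase `φ` of `t ↦ ξ(1/2 + h − it)` with `ξ(1/2 + h − it) = |ξ(1/2 + h − it)| e^{−iφ(t)}`
and `φ(v) − φ(u) = ∫ᵤᵛ Re (ξ'/ξ)(1/2 + h + it) dt`. -/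
theorem stub_xiPhase :
    ∀ (h : ℝ), 1 / 2 < h →
      (∃ C : ℝ, ∀ s : ℂ, 3 / 4 + h / 2 ≤ s.re →
        ‖deriv riemannXi s / riemannXi s‖ ≤ C * (1 + ‖s‖)) ∧
      (∃ φ : ℝ → ℝ, (∀ t : ℝ, riemannXi (1 / 2 + h - I * t) =
          ((‖riemannXi (1 / 2 + h - I * t)‖ : ℝ) : ℂ) * cexp (-(((φ t : ℝ) : ℂ) * I))) ∧
        (∀ u v : ℝ, φ v - φ u =
          ∫ t in u..v, (deriv riemannXi (1 / 2 + h + t * I) / riemannXi (1 / 2 + h + t * I)).re)) :=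
  fun _h hh => ⟨xiPhase_exists_norm_logDeriv_le (by linarith), xiPhase_exists_phase hh.le⟩

end Summit.RiemannHypothesis.RiemannHypothesis.Theorems.SpectralTraceWindowTraceArch

end
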